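import Summits.RiemannHypothesis.RiemannHypothesis.Theorems.GapsEvoDoorsInOptKernel

/-!
# GapsEvoDoors — IN-OPT certificate, part 2: list-sum calculus

The data of the certificate enter as list literals; this file proves the generic calculus over lists
(continuity, integrability, `∫ Σ = Σ ∫`, the inner `v`-integral `∫₀^a (Σ Aᵢ v^{dᵢ}) v^s`) and the
three one-variable element integrals against `pLo`/`qLo` (inner `u₂`-stage on `[0, β]`, outer
`u₁`-stage with merged powers, `T_A`/`T_C` stages). computed-record rung: executes the higher-degree
optimisation anticipated in Inoue 2026 (arXiv:2604.05733) Remark 1; no printed constant below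
0.508949 under RH alone as of 2026-08; instrument rows eng-2 j289119/j289121, eng-1 R-aIN-E1-g0-01
j289591/j289692/j289724, referee VERDICTS.md 3e883a7033d14144 V-2/V-3/V-4; PREREG A1
cd26ffc3f46dafba; conditional on RH and on `inoue2026_theorem2` (preprint CLAIM); μ-currency RECORD
class, not the CI door; computed ≠ proved outside this kernel certificate; nothing here bears on the
truth of RH.
-/

noncomputable section

open MeasureTheory Set Finset Real Literature.NumberTheory.LFunctions

open scoped Real Interval

set_option linter.dupNamespace false  -- the mandated namespace repeats `RiemannHypothesis`

namespace Summit.RiemannHypothesis.RiemannHypothesis.Theorems.GapsEvoDoorsInOpt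

/-! ### 4. List-sum calculus (data enters as list literals; all calculus is generic in the tuple fields) -/

/-- `pLo` as a `Finset` sum of its monomials. -/
theorem pLo_eq_sum (u : ℝ) : pLo u = ∑ m ∈ range 4, pc m * u ^ (2 * m) := by
  simp only [Finset.sum_range_succ, Finset.sum_range_zero, pc, pLo]; ring

/-- `qLo` as a `Finset` sum of its monomials. -/
theorem qLo_eq_sum (u : ℝ) : qLo u = ∑ m ∈ range 6, qc m * u ^ (2 * m + 1) := by
  simp only [Finset.sum_range_succ, Finset.sum_range_zero, qc, qLo]; ring

/-- `pLo` is continuous (a polynomial). -/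
theorem pLo_continuous : Continuous pLo := by unfold pLo; fun_prop

/-- `qLo` is continuous (a polynomial). -/
theorem qLo_continuous : Continuous qLo := by unfold qLo; fun_prop

/-- Continuity of a list-indexed finite sum of continuous functions. [folklore] -/
theorem continuous_listSum {ι X : Type*} [TopologicalSpace X] (l : List ι) (g : ι → X → ℝ)
    (h : ∀ i, Continuous (g i)) : Continuous fun u => (l.map (fun i => g i u)).sum := by
  induction l with
  | nil => simpa using continuous_const
  | cons i l ih =>
    simp only [List.map_cons, List.sum_cons]
    exact (h i).add ih

/-- Interval-integrability of a list-indexed finite sum. [folklore] -/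
theorem intervalIntegrable_listSum {ι : Type*} (l : List ι) (f : ι → ℝ → ℝ) {a b : ℝ}
    (h : ∀ i, IntervalIntegrable (f i) volume a b) :
    IntervalIntegrable (fun x => (l.map (fun i => f i x)).sum) volume a b := by
  induction l with
  | nil => simp
  | cons i l ih =>
    have e : (fun x => ((i :: l).map (fun j => f j x)).sum) = fun x => f i x + (l.map (fun j => f j x)).sum := by
      funext x; simp [List.map_cons, List.sum_cons]
    rw [e]
    exact (h i).add ih

/-- `∫ (Σ_list f_i) = Σ_list ∫ f_i` for interval-integrable summands. [folklore] -/
theorem integral_listSum {ι : Type*} (l : List ι) (f : ι → ℝ → ℝ) {a b : ℝ}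
    (h : ∀ i, IntervalIntegrable (f i) volume a b) :
    ∫ x in a..b, (l.map (fun i => f i x)).sum = (l.map (fun i => ∫ x in a..b, f i x)).sum := by
  induction l with
  | nil => simp
  | cons i l ih =>
    simp only [List.map_cons, List.sum_cons]
    rw [intervalIntegral.integral_add (h i) (intervalIntegrable_listSum l f h), ih]

/-- `Σ_list` version of the inner `v`-integral: `∫₀^a (Σ_i A_i v^{d_i}) v^s dv = Σ_i A_i a^{s+1+d_i}/(s+1+d_i)`. [folklore] -/
theorem integral_listSum_pow_rpow {ι : Type*} (l : List ι) (A : ι → ℝ) (d : ι → ℕ) {s a : ℝ} (hs : 0 < s) (ha : 0 ≤ a) :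
    ∫ v in (0 : ℝ)..a, (l.map (fun i => A i * v ^ d i)).sum * v ^ s
      = (l.map (fun i => A i * (a ^ (s + 1 + d i) / (s + 1 + d i)))).sum := by
  have hI : ∀ k : ℕ, ∫ v in (0 : ℝ)..a, v ^ k * v ^ s = a ^ (s + 1 + k) / (s + 1 + k) := by
    intro k
    have e : EqOn (fun v : ℝ => v ^ k * v ^ s) (fun v => v ^ (s + k)) (Set.uIcc 0 a) := by
      intro v hv
      rw [Set.uIcc_of_le ha] at hv
      simp only
      rw [Real.rpow_add_of_nonneg hv.1 hs.le (Nat.cast_nonneg k), Real.rpow_natCast, mul_comm]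
    rw [intervalIntegral.integral_congr e,
      integral_rpow (Or.inl (by have hk : (0 : ℝ) ≤ k := Nat.cast_nonneg k; linarith))]
    rw [Real.zero_rpow (ne_of_gt (by positivity))]
    have : s + ↑k + 1 = s + 1 + ↑k := by ring
    rw [this]; ring
  have e1 : ∀ v : ℝ, (l.map (fun i => A i * v ^ d i)).sum * v ^ s = (l.map (fun i => A i * (v ^ d i * v ^ s))).sum := by
    intro v; rw [← List.sum_map_mul_right]; congr 1; apply List.map_congr_left; intro i _; ring
  simp_rw [e1]
  rw [integral_listSum l (fun i v => A i * (v ^ d i * v ^ s))]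
  · congr 1; apply List.map_congr_left; intro i _
    rw [intervalIntegral.integral_const_mul, hI (d i)]
  · intro i
    exact ((continuous_const.mul ((continuous_pow (d i)).mul (Real.continuous_rpow_const hs.le)))).intervalIntegrable _ _

/-- Inner `u₂`-stage element: `∫₀^β pLo(u)·(C u^b (β−u)^T/T) du = (C/T) Σ_{m<4} pc m β^{2m+b+1} β^T J(2m+b,T)`. -/
theorem elem_inner (C : ℝ) (b : ℕ) {T β : ℝ} (hT : 0 < T) (hβ : 0 ≤ β) :
    ∫ u in (0 : ℝ)..β, pLo u * (C * u ^ b * ((β - u) ^ T / T))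
      = C / T * ∑ m ∈ range 4, pc m * (β ^ (2 * m + b + 1) * β ^ T * betaJ (2 * m + b) T) := by
  have e : ∀ u : ℝ, pLo u * (C * u ^ b * ((β - u) ^ T / T))
      = C / T * ((∑ m ∈ range 4, pc m * u ^ (2 * m + b)) * (β - u) ^ T) := by
    intro u
    rw [pLo_eq_sum]
    simp only [Finset.sum_mul, Finset.mul_sum]
    refine Finset.sum_congr rfl fun m _ => ?_
    rw [pow_add]; ring
  simp_rw [e]
  rw [intervalIntegral.integral_const_mul, integral_polySum_mul_sub_rpow 4 pc (fun m => 2 * m + b) hT hβ]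

/-- `(1−u)^k (1−u)^t = (1−u)^{t+k}` for `u ≤ 1`, `t ≥ 0`. [folklore] -/
theorem pow_mul_rpow_one_sub {u : ℝ} (hu : u ≤ 1) (k : ℕ) {t : ℝ} (ht : 0 ≤ t) :
    (1 - u) ^ k * (1 - u) ^ t = (1 - u) ^ (t + k) := by
  rw [Real.rpow_add_of_nonneg (sub_nonneg.2 hu) ht (Nat.cast_nonneg k), Real.rpow_natCast, mul_comm]

/-- Outer `u₁`-stage element: `∫₀¹ pLo(u)·(C u^a (1−u)^k (1−u)^T) du = C Σ_{m<4} pc m J(2m+a, T+k)`. -/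
theorem elem_outer (C : ℝ) (a k : ℕ) {T : ℝ} (hT : 0 < T) :
    ∫ u in (0 : ℝ)..1, pLo u * (C * u ^ a * ((1 - u) ^ k * (1 - u) ^ T))
      = C * ∑ m ∈ range 4, pc m * betaJ (2 * m + a) (T + k) := by
  have e : EqOn (fun u : ℝ => pLo u * (C * u ^ a * ((1 - u) ^ k * (1 - u) ^ T)))
      (fun u => C * ((∑ m ∈ range 4, pc m * u ^ (2 * m + a)) * (1 - u) ^ (T + k))) (Set.uIcc 0 1) := by
    intro u hu
    rw [Set.uIcc_of_le zero_le_one] at hu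
    simp only
    rw [pow_mul_rpow_one_sub hu.2 k hT.le, pLo_eq_sum]
    simp only [Finset.sum_mul, Finset.mul_sum]
    refine Finset.sum_congr rfl fun m _ => ?_
    rw [pow_add]; ring
  rw [intervalIntegral.integral_congr e, intervalIntegral.integral_const_mul,
    integral_polySum_mul_rpow 4 pc (fun m => 2 * m + a) (by positivity)]

/-- `T_A`-stage element: `∫₀¹ pLo(u)·(C u^j (1−u)^T/T) du = (C/T) Σ_{m<4} pc m J(2m+j, T)`. -/
theorem elem_A (C : ℝ) (j : ℕ) {T : ℝ} (hT : 0 < T) :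
    ∫ u in (0 : ℝ)..1, pLo u * (C * u ^ j * ((1 - u) ^ T / T))
      = C / T * ∑ m ∈ range 4, pc m * betaJ (2 * m + j) T := by
  have e : ∀ u : ℝ, pLo u * (C * u ^ j * ((1 - u) ^ T / T))
      = C / T * ((∑ m ∈ range 4, pc m * u ^ (2 * m + j)) * (1 - u) ^ T) := by
    intro u
    rw [pLo_eq_sum]
    simp only [Finset.sum_mul, Finset.mul_sum]
    refine Finset.sum_congr rfl fun m _ => ?_
    rw [pow_add]; ring
  simp_rw [e]
  rw [intervalIntegral.integral_const_mul, integral_polySum_mul_rpow 4 pc (fun m => 2 * m + j) hT]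

/-- `T_C`-stage element: `∫₀¹ qLo(u)·(C (1−u)^T/T) du = (C/T) Σ_{m<6} qc m J(2m+1, T)`. -/
theorem elem_C (C : ℝ) {T : ℝ} (hT : 0 < T) :
    ∫ u in (0 : ℝ)..1, qLo u * (C * ((1 - u) ^ T / T))
      = C / T * ∑ m ∈ range 6, qc m * betaJ (2 * m + 1) T := by
  have e : ∀ u : ℝ, qLo u * (C * ((1 - u) ^ T / T))
      = C / T * ((∑ m ∈ range 6, qc m * u ^ (2 * m + 1)) * (1 - u) ^ T) := by
    intro u
    rw [qLo_eq_sum]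
    simp only [Finset.sum_mul, Finset.mul_sum]
    refine Finset.sum_congr rfl fun m _ => ?_
    ring
  simp_rw [e]
  rw [intervalIntegral.integral_const_mul, integral_polySum_mul_rpow 6 qc (fun m => 2 * m + 1) hT]

end Summit.RiemannHypothesis.RiemannHypothesis.Theorems.GapsEvoDoorsInOpt

end
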